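import Summits.QuantumFields.YangMills.Theorems.BalabanUVNodesN16DetTransport
import Summits.QuantumFields.YangMills.Theorems.BalabanUVNodesN16Exists8UniformScalar
import HarnessLib

/-!
# YM-DAG node N16 (NE3), the re-keyed N07 in-edge — AT EVERY RANK `n`, EVERY MINIMISER AT A UNIFORM-CURVATURE SCALAR DATUM HAS CENTRAL UNIFORM PLAQUETTES: on the scalar
# uniform-curvature data `𝒟_unif` the constrained minimisers of [Balaban1985Variational]'s problem over the (8)-class, for `U(n)`-valued competitors, have plaquette variables
# `e^{±iω∕L^{2k}}·1` on the `(e₀,e₁)`-plane and `1` elsewhere, and the minimal action is the rank-one value `L^{(4−(d+2))k}·(N L^k)^{d+2}·(1 − cos(ω∕L^{2k}))` (file C of the g7 piece)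

Cell `pub-ymgap`, width seat `pub-ymgap-dag-n16-w2` (director-ym №197 ∕ HUMAN RULING D-0149), generation 7.  `--kind proof --supports stmt-QuantumFields-27366 --as helper`
(K3⁸, KEY MAP v2).  `bears_on: R4∕N16`, edge N07 → N16.  COUNT-NEUTRAL.

HONEST FRAMING.  The g6 rank-one picture (`…N16UniformScalarMinimisers`, `[Unique n]`) EXTENDED TO EVERY RANK by DET-TRANSPORT (file B: the determinant configuration of an
admissible `U(n)`-valued competitor is an admissible `U(1)`-valued competitor at the datum of curvature `n·ω`, to which g6 file 5's flux transport applies) and TWO Jensens (file A: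
over the eigenangles of each plaquette variable; g6 file 6a: over the period box).  It is NOT [Balaban1985Variational] Theorem 1: general (non-uniform, non-scalar) data are untouched,
and UNIQUENESS UP TO GAUGE at rank `n ≥ 2` is NOT claimed here (flat `U(n)` twists).  Nothing of Bałaban is asserted or refuted; DischargeTest `stub_reg910Slot` NOT closed; no K3⁸ v6
stub named or closed; N16 ∕ N07 NOT discharged; counts UNMOVED (typed 28∕28 · discharged 5∕27 · A 5∕28).  R4 closes the conditional finite-𝕋⁴ rung `BalabanLadder.UV` only; NOT
ℝ⁴ ∕ OS ∕ mass gap; the YM mass gap (Clay) is NOT proved by any of this.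

WHAT IS PROVED ([folklore] bookkeeping + cited shapes, 0 `sorry`, 0 `def`; `n` any non-empty index type; REGIME = leaf-05's with the class radius RANK-SCALED — `16·C0·(2n·ec) ≤ 3`,
`1024(d+3)(d+6)L²·(2n·ec) ≤ 1`, `|n·ω| ≤ 1∕2` — constants depending on the gauge group, as in print).  §1 `tau_hol_eq_toIocMod` (the determinant phase of a plaquette variable
of `U` IS the principal plaquette angle of a real presentation of its determinant configuration), `regime_aux`, `hol01_det_datum`, ★★ `sum_tau_periodBox` (**THE RANK-`n` FLUX
IDENTITY** `(NL^k)²·Σ_{x ∈ [0,NL^k)^{d+2}} τ(U(∂p₀₁(x))) = (NL^k)^{d+2}·N²·n·ω` for every admissible competitor — g6 file 5 `sliceFlux_of_admissible` on the determinant configuration),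
`mean_tau_periodBox`.  §2 ★★ `levelAction_ge_of_admissible` (**at every rank, every admissible competitor has `levelAction ≥ (stepWt⁻¹)^k·(NL^k)^{d+2}·(1 − cos(ω∕L^{2k}))`**),
`levelAction_of_central_plaquettes` (central uniform plaquettes `e^{±if}·1` attain `(stepWt⁻¹)^k·(NL^k)^{d+2}·(1 − cos f)`), ★★★ `minAct_uniformScalar` (THE MINIMAL ACTION at every
rank, attained by g6 file 3's uniform preimage), ★★★ `plaquettes_of_isMinimiser` (**EVERY MINIMISER HAS CENTRAL UNIFORM PLAQUETTES** `e^{±iω∕L^{2k}}·1` ∕ `1`: the three chained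
inequalities are equalities — other planes weigh `0` ⟹ `= 1` (file A `eq_one_of_wt_eq_zero`); per-plaquette rigidity (file A `eq_smul_one_of_wt_eq`); Jensen's equality case over the
box (6a); periodicity moves off the box).
DEPENDENCES (by name): file A (`one_sub_cos_tau_le_wt`, `eq_smul_one_of_wt_eq`, `eq_one_of_wt_eq_zero`, `abs_tau_div_le`, `abs_tau_le`, `det_eq_cexp_tau`, `det_cexp_smul_one`); file B
(`exists_det_cfg`, `hol_det`, `isUnitaryCfg_det`, `admissible_det`, `det_scalarCfg_imag`); g6 files 3 (`exists_periodic_uniform_preimage`), 4 (`val_hol_plaqWord_real`,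
`toIocMod_eq_of_cexp_smul_one_eq`), 5 (`sliceFlux_of_admissible`), 6a (`exists_real_presentation`, `sum_perWin_ge_plane01`, `wt_eq_zero_of_sum_perWin_eq`, `jensen_one_sub_cos[_eq_iff]`);
`T4AveragingDeficitWallBoundary`; `MinimalActionLevels`; `MinimalActionSandwich`; `MinimalActionRate`; `T4AveragingDeficitNonAbelian.hol_add_period`; `PeriodicChoice`; `B7Prop1Explicit`.
-/

open scoped BigOperators Matrix Matrix.Norms.L2Operator
open NormedSpace Finset

namespace Summit.QuantumFields.YangMills.BalabanUVNodes.N16RankNUniformScalarMinimisers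

open Literature.MathematicalPhysics.QuantumFieldTheory.Balaban1983to89
open B7Prop1Explicit B7Prop2Explicit MatrixLog UnitaryModel
open T4AveragingDeficitWall hiding Site Plane Plaq Bond
open T4AveragingDeficitWallBoundary (scalarCfg IsPeriodicCfg periodBox card_periodBox mem_periodBox π₀ snd_ne_one_of_ne snd_ne_zero wt_expUnit_smul_one fin_zero_ne_one)
open FederbushMean (cexp_smul_one)
open T4AveragingDeficitNonAbelian (hol_add_period)
open Summit.QuantumFields.BalabanUV.T4Continuum
open MinimalActionLevels (levelAction perWin stepWt stepWt_pos)
open MinimalActionSandwich (IsMinimiser admissible minAct)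
open MinimalActionRate (sfClass)
open PeriodicChoice (apply_wrap_eq wrap_mem_periodBox)
open Summit.QuantumFields.YangMills.BalabanUVNodes.N16Exists8UniformScalar (exists_periodic_uniform_preimage)
open Summit.QuantumFields.YangMills.BalabanUVNodes.N16ScalarAverageChern (val_hol_plaqWord_real toIocMod_eq_of_cexp_smul_one_eq cexp_toIocMod_mul_I)
open Summit.QuantumFields.YangMills.BalabanUVNodes.N16ScalarFluxTransport (sliceFlux_of_admissible)
open Summit.QuantumFields.YangMills.BalabanUVNodes.N16UniformScalarJensen (exists_real_presentation sum_perWin_ge_plane01 wt_eq_zero_of_sum_perWin_eq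
  jensen_one_sub_cos jensen_one_sub_cos_eq_iff)
open Summit.QuantumFields.YangMills.BalabanUVNodes.N16RankNWilsonWeightDetPhase (one_sub_cos_tau_le_wt eq_smul_one_of_wt_eq eq_one_of_wt_eq_zero abs_tau_div_le abs_tau_le
  det_eq_cexp_tau det_cexp_smul_one)
open Summit.QuantumFields.YangMills.BalabanUVNodes.N16DetTransport (exists_det_cfg hol_det isUnitaryCfg_det admissible_det det_scalarCfg_imag)

noncomputable section

variable {d : ℕ} {n : Type} [Fintype n] [DecidableEq n] [Nonempty n]

/-! ## §1 The rank-`n` flux identity: the determinant phases of the `(e₀,e₁)`-plaquettes of an admissible competitor sum to `n·(NL^k)^d·N²·ω` -/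

/-- **The determinant phase IS the principal plaquette angle of the determinant configuration**: if `u = e^{iA}·1` (rank one, real potential `A`) is a determinant configuration of the
`U(n)`-valued `U` and `n·|U(∂p) − 1| ≤ 1∕3`, then `τ(U(∂p)) = θ_A(∂p) := toIocMod 2π (−π) A(∂p)` (`e^{iτ}·1 = det U(∂p)·1 = u(∂p) = e^{iθ_A}·1` with both angles in `]−π, π]`).
[folklore] -/
theorem tau_hol_eq_toIocMod {m : Type} [Fintype m] [DecidableEq m] [Nonempty m] {U : B7Prop1Explicit.Site d → Fin d → (Matrix n n ℂ)ˣ} (hU : IsUnitaryCfg U)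
    {A : B7Prop1Explicit.Site d → Fin d → ℝ}
    (hdet : ∀ x κ, ((scalarCfg (n := m) (fun y ν => ((A y ν : ℝ) : ℂ) * Complex.I) x κ : (Matrix m m ℂ)ˣ) : Matrix m m ℂ) = (U x κ : Matrix n n ℂ).det • (1 : Matrix m m ℂ))
    (x : B7Prop1Explicit.Site d) {κ μ : Fin d} (hs : Fintype.card n * ‖((hol U x (plaqWord κ μ) : (Matrix n n ℂ)ˣ) : Matrix n n ℂ) - 1‖ ≤ 1 / 3) :
    (mlog ((hol U x (plaqWord κ μ) : (Matrix n n ℂ)ˣ) : Matrix n n ℂ)).trace.im = toIocMod Real.two_pi_pos (-Real.pi) (asum A x (plaqWord κ μ)) := by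
  set W : Matrix n n ℂ := ((hol U x (plaqWord κ μ) : (Matrix n n ℂ)ˣ) : Matrix n n ℂ) with hW
  have hc1 : (1 : ℝ) ≤ Fintype.card n := by exact_mod_cast Fintype.card_pos
  have hs3 : ‖W - 1‖ ≤ 1 / 3 := by have h0 := norm_nonneg (W - 1); nlinarith
  have hWu : W ∈ Matrix.unitaryGroup n ℂ := mem_unitaryUnits.mp (hol_mem_of hU x _)
  have h1 := val_hol_plaqWord_real (n := m) A x κ μ
  rw [hol_det hdet, det_eq_cexp_tau hWu hs3] at h1
  have h2 := toIocMod_eq_of_cexp_smul_one_eq (n := m) h1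
  rw [toIocMod_toIocMod] at h2
  rw [← h2, eq_comm, toIocMod_eq_self, Set.mem_Ioc]
  have hτ := abs_le.mp (abs_tau_le (W := W) (hs3.trans (by norm_num)))
  have hb : 2 * (Fintype.card n : ℝ) * ‖W - 1‖ ≤ 2 / 3 := by linarith
  constructor <;> linarith [Real.pi_gt_three]

omit [DecidableEq n] in
/-- **Regime bookkeeping** (rank-scaled leaf-05): `1024(d+3)(d+6)L²·(2n·ec) ≤ 1` with `L ≥ 2` gives `n·ec ≤ 1∕3`, `ec ≤ 1∕3` and the determinant-transport regime
`1024·n·(d+3)(d+6)L²·ec ≤ 1` of file B. [folklore] -/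
theorem regime_aux {L : ℕ} (hL : 2 ≤ L) {ec : ℝ} (he0 : 0 ≤ ec)
    (he2n : 1024 * ((d + 2 : ℕ) + 1 : ℝ) * ((d + 2 : ℕ) + 4) * (L : ℝ) ^ 2 * (2 * Fintype.card n * ec) ≤ 1) :
    Fintype.card n * ec ≤ 1 / 3 ∧ ec ≤ 1 / 3 ∧ 1024 * Fintype.card n * (((d + 2 : ℕ) : ℝ) + 1) * ((d + 2 : ℕ) + 4) * (L : ℝ) ^ 2 * ec ≤ 1 := by
  have hc1 : (1 : ℝ) ≤ Fintype.card n := by exact_mod_cast Fintype.card_pos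
  have hd0 : (0 : ℝ) ≤ d := by positivity
  have hL2r : (2 : ℝ) ≤ L := by exact_mod_cast hL
  have h4 : (18 : ℝ) ≤ ((d + 2 : ℕ) + 1 : ℝ) * ((d + 2 : ℕ) + 4) := by push_cast; nlinarith
  have hL4 : (4 : ℝ) ≤ (L : ℝ) ^ 2 := by nlinarith
  have h16 : (72 : ℝ) ≤ ((d + 2 : ℕ) + 1 : ℝ) * ((d + 2 : ℕ) + 4) * (L : ℝ) ^ 2 := by
    have := mul_le_mul h4 hL4 (by norm_num) (by positivity); linarith
  have hne0 : 0 ≤ 2 * Fintype.card n * ec := by positivity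
  have key : 1024 * (((d + 2 : ℕ) + 1 : ℝ) * ((d + 2 : ℕ) + 4) * (L : ℝ) ^ 2) * (2 * Fintype.card n * ec) ≤ 1 := by
    calc 1024 * (((d + 2 : ℕ) + 1 : ℝ) * ((d + 2 : ℕ) + 4) * (L : ℝ) ^ 2) * (2 * Fintype.card n * ec)
        = 1024 * ((d + 2 : ℕ) + 1 : ℝ) * ((d + 2 : ℕ) + 4) * (L : ℝ) ^ 2 * (2 * Fintype.card n * ec) := by ring
      _ ≤ 1 := he2n
  have h72 : 72 * (2 * Fintype.card n * ec) ≤ ((d + 2 : ℕ) + 1 : ℝ) * ((d + 2 : ℕ) + 4) * (L : ℝ) ^ 2 * (2 * Fintype.card n * ec) :=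
    mul_le_mul_of_nonneg_right h16 hne0
  have hnec : Fintype.card n * ec ≤ 1 / 3 := by nlinarith
  have hec : ec ≤ 1 / 3 := by nlinarith
  refine ⟨hnec, hec, ?_⟩
  calc 1024 * Fintype.card n * (((d + 2 : ℕ) : ℝ) + 1) * ((d + 2 : ℕ) + 4) * (L : ℝ) ^ 2 * ec
      = (1024 * ((d + 2 : ℕ) + 1 : ℝ) * ((d + 2 : ℕ) + 4) * (L : ℝ) ^ 2 * (2 * Fintype.card n * ec)) / 2 := by push_cast; ring
    _ ≤ 1 := by linarith

omit [Nonempty n] in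
/-- **The determinant datum has `(e₀,e₁)`-plaquettes `e^{inω}·1`**: if the scalar datum `V = e^{iG}·1_n` has `V(∂p₀₁) = e^{iω}·1_n` everywhere, its determinant configuration `e^{inG}·1_m`
has `(e₀,e₁)`-plaquettes `e^{inω}·1_m`. [folklore] -/
theorem hol01_det_datum {m : Type} [Fintype m] [DecidableEq m] {G : B7Prop1Explicit.Site (d + 2) → Fin (d + 2) → ℝ} {ω : ℝ}
    (hV01 : ∀ x : B7Prop1Explicit.Site (d + 2), hol (scalarCfg (n := n) (fun y ν => ((G y ν : ℝ) : ℂ) * Complex.I)) x (plaqWord 0 1)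
      = expUnit ((((ω : ℝ) : ℂ) * Complex.I) • (1 : Matrix n n ℂ))) (x : B7Prop1Explicit.Site (d + 2)) :
    hol (scalarCfg (n := m) (fun y ν => (((Fintype.card n * G y ν : ℝ)) : ℂ) * Complex.I)) x (plaqWord 0 1)
      = expUnit (((((Fintype.card n * ω : ℝ)) : ℂ) * Complex.I) • (1 : Matrix m m ℂ)) := by
  apply Units.ext
  rw [hol_det (det_scalarCfg_imag (n := n) (m := m) G), hV01 x, val_expUnit, val_expUnit, ← cexp_smul_one, ← cexp_smul_one, det_cexp_smul_one]

/-- **★★ THE RANK-`n` FLUX IDENTITY**: at an `N`-periodic scalar datum `V = e^{iG}·1_n` of uniform `(e₀,e₁)`-curvature `ω` (`L ≥ 2`, `N ≥ 1`, the rank-scaled regime), every admissible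
`U(n)`-valued competitor `U` of run `k` over `sfClass (d+2) L N ec` has `(NL^k)²·Σ_{x ∈ [0,NL^k)^{d+2}} τ(U(∂p₀₁(x))) = (NL^k)^{d+2}·N²·(n·ω)` — g6 file 5 applied to the (rank-one)
determinant configuration, whose datum has curvature `n·ω`. [cite: Balaban1985Variational, (8) p.279] -/
theorem sum_tau_periodBox {L : ℕ} (hL : 2 ≤ L) {N : ℕ} (hN : 1 ≤ N) {ec : ℝ} (he0 : 0 ≤ ec) (he1n : 16 * C0 (d + 2) * (2 * Fintype.card n * ec) ≤ 3)
    (he2n : 1024 * ((d + 2 : ℕ) + 1 : ℝ) * ((d + 2 : ℕ) + 4) * (L : ℝ) ^ 2 * (2 * Fintype.card n * ec) ≤ 1) {k : ℕ} {ω : ℝ} (hωn : |Fintype.card n * ω| ≤ 1 / 2)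
    {G : B7Prop1Explicit.Site (d + 2) → Fin (d + 2) → ℝ}
    (hV01 : ∀ x : B7Prop1Explicit.Site (d + 2), hol (scalarCfg (n := n) (fun y ν => ((G y ν : ℝ) : ℂ) * Complex.I)) x (plaqWord 0 1)
      = expUnit ((((ω : ℝ) : ℂ) * Complex.I) • (1 : Matrix n n ℂ)))
    {U : B7Prop1Explicit.Site (d + 2) → Fin (d + 2) → (Matrix n n ℂ)ˣ}
    (hU : U ∈ admissible (sfClass (d + 2) L N ec) L k (scalarCfg (n := n) (fun y ν => ((G y ν : ℝ) : ℂ) * Complex.I))) :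
    ((N * L ^ k : ℕ) : ℝ) ^ 2 * ∑ x ∈ periodBox (N * L ^ k), (mlog ((hol U x (plaqWord 0 1) : (Matrix n n ℂ)ˣ) : Matrix n n ℂ)).trace.im
      = ((N * L ^ k : ℕ) : ℝ) ^ (d + 2) * ((N : ℝ) ^ 2 * (Fintype.card n * ω)) := by
  have hc1 : (1 : ℝ) ≤ Fintype.card n := by exact_mod_cast Fintype.card_pos
  have hC : 0 < C0 (d + 2) := C0_pos (d + 2)
  obtain ⟨hnec, -, he2B⟩ := regime_aux (n := n) hL he0 he2n
  -- the regime for `U` itself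
  have hmono : ec ≤ 2 * Fintype.card n * ec := by nlinarith
  have he1 : 16 * C0 (d + 2) * ec ≤ 3 := (mul_le_mul_of_nonneg_left hmono (by positivity)).trans he1n
  -- the determinant configuration (rank one) and its real presentation
  obtain ⟨u, hdet⟩ := exists_det_cfg (m := Fin 1) U
  have hadm' := admissible_det (m := Fin 1) hL he0 he1 he2B hdet hU
  obtain ⟨A, hA⟩ := exists_real_presentation (n := Fin 1) (isUnitaryCfg_det hdet hU.1.1)
  rw [hA] at hadm' hdet
  -- g6 file 5 at rank one, datum curvature `n·ω`, class radius `2n·ec`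
  have he0' : 0 ≤ 2 * Fintype.card n * ec := by positivity
  obtain ⟨-, hbox⟩ := sliceFlux_of_admissible (n := Fin 1) hL hN he0' he1n he2n (ω := Fintype.card n * ω) hωn
    (G := fun y ν => Fintype.card n * G y ν) (A := A) (hol01_det_datum (n := n) (m := Fin 1) hV01) hadm'
  rw [← hbox]; congr 1; refine Finset.sum_congr rfl fun x _ => ?_
  -- the guard at `x`: `n‖U(∂p) − 1‖ ≤ n·ec ≤ 1/3`
  refine tau_hol_eq_toIocMod (m := Fin 1) hU.1.1 hdet x ?_
  have hL1r : (1 : ℝ) ≤ ((L : ℝ) ^ k) ^ 2 := one_le_pow₀ (one_le_pow₀ (by exact_mod_cast (show 1 ≤ L by omega)))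
  have hs := (hU.1.2.2 x 0 1 fin_zero_ne_one).trans (div_le_self he0 hL1r)
  have hc0 : (0 : ℝ) ≤ Fintype.card n := by positivity
  exact (mul_le_mul_of_nonneg_left hs hc0).trans hnec

/-- **The MEAN normalised determinant phase of an admissible competitor is `ω∕L^{2k}`** (the flux identity divided by `n·(NL^k)^{d+2}`). [cite: Balaban1985Variational, (8) p.279] -/
theorem mean_tau_periodBox {L : ℕ} (hL : 2 ≤ L) {N : ℕ} (hN : 1 ≤ N) {ec : ℝ} (he0 : 0 ≤ ec) (he1n : 16 * C0 (d + 2) * (2 * Fintype.card n * ec) ≤ 3)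
    (he2n : 1024 * ((d + 2 : ℕ) + 1 : ℝ) * ((d + 2 : ℕ) + 4) * (L : ℝ) ^ 2 * (2 * Fintype.card n * ec) ≤ 1) {k : ℕ} {ω : ℝ} (hωn : |Fintype.card n * ω| ≤ 1 / 2)
    {G : B7Prop1Explicit.Site (d + 2) → Fin (d + 2) → ℝ}
    (hV01 : ∀ x : B7Prop1Explicit.Site (d + 2), hol (scalarCfg (n := n) (fun y ν => ((G y ν : ℝ) : ℂ) * Complex.I)) x (plaqWord 0 1)
      = expUnit ((((ω : ℝ) : ℂ) * Complex.I) • (1 : Matrix n n ℂ)))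
    {U : B7Prop1Explicit.Site (d + 2) → Fin (d + 2) → (Matrix n n ℂ)ˣ}
    (hU : U ∈ admissible (sfClass (d + 2) L N ec) L k (scalarCfg (n := n) (fun y ν => ((G y ν : ℝ) : ℂ) * Complex.I))) :
    (∑ x ∈ periodBox (N * L ^ k), (mlog ((hol U x (plaqWord 0 1) : (Matrix n n ℂ)ˣ) : Matrix n n ℂ)).trace.im / Fintype.card n) / (periodBox (d := d + 2) (N * L ^ k)).card
      = ω / (L : ℝ) ^ (2 * k) := by
  have hbox := sum_tau_periodBox hL hN he0 he1n he2n hωn hV01 hU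
  have hMne : (((N * L ^ k : ℕ)) : ℝ) ≠ 0 := by exact_mod_cast Nat.mul_ne_zero (by omega) (pow_ne_zero _ (by omega))
  have hc : (Fintype.card n : ℝ) ≠ 0 := by exact_mod_cast Fintype.card_ne_zero
  have hN0 : (N : ℝ) ≠ 0 := by exact_mod_cast (show N ≠ 0 by omega)
  have hL0 : (L : ℝ) ≠ 0 := by exact_mod_cast (show L ≠ 0 by omega)
  have hsum : ∑ x ∈ periodBox (N * L ^ k), (mlog ((hol U x (plaqWord 0 1) : (Matrix n n ℂ)ˣ) : Matrix n n ℂ)).trace.im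
      = (((N * L ^ k : ℕ)) : ℝ) ^ d * ((N : ℝ) ^ 2 * (Fintype.card n * ω)) := by
    apply mul_left_cancel₀ (pow_ne_zero 2 hMne); rw [hbox]; ring
  rw [← Finset.sum_div, card_periodBox, hsum, Nat.cast_pow, Nat.cast_mul, Nat.cast_pow, pow_mul]
  field_simp; ring

/-! ## §2 Minimisers at a uniform-curvature scalar datum, every rank -/

section Minimisers

variable {L N k : ℕ} {ec ω : ℝ} {G : B7Prop1Explicit.Site (d + 2) → Fin (d + 2) → ℝ}

/-- **★★ THE LOWER BOUND AT EVERY RANK**: at an `N`-periodic scalar datum `V = e^{iG}·1_n` of uniform `(e₀,e₁)`-curvature `ω` (rank-scaled regime; `L ≥ 2`, `N ≥ 1`), EVERY admissible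
`U(n)`-valued competitor of run `k` over `sfClass (d+2) L N ec` has `levelAction ≥ (stepWt⁻¹)^k · (N L^k)^{d+2} · (1 − cos(ω ∕ L^{2k}))` — the `(e₀,e₁)`-plane part dominates
`Σ_x (1 − cos(τ_x∕n))` (file A, Jensen over eigenangles), whose mean angle is `ω∕L^{2k}` (§1), and Jensen over the period box. [cite: Balaban1985Variational, (5)–(8) pp.278–279] -/
theorem levelAction_ge_of_admissible (hL : 2 ≤ L) (hN : 1 ≤ N) (he0 : 0 ≤ ec) (he1n : 16 * C0 (d + 2) * (2 * Fintype.card n * ec) ≤ 3)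
    (he2n : 1024 * ((d + 2 : ℕ) + 1 : ℝ) * ((d + 2 : ℕ) + 4) * (L : ℝ) ^ 2 * (2 * Fintype.card n * ec) ≤ 1) (hωn : |Fintype.card n * ω| ≤ 1 / 2)
    (hV01 : ∀ x : B7Prop1Explicit.Site (d + 2), hol (scalarCfg (n := n) (fun y ν => ((G y ν : ℝ) : ℂ) * Complex.I)) x (plaqWord 0 1)
      = expUnit ((((ω : ℝ) : ℂ) * Complex.I) • (1 : Matrix n n ℂ)))
    {U : B7Prop1Explicit.Site (d + 2) → Fin (d + 2) → (Matrix n n ℂ)ˣ}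
    (hU : U ∈ admissible (sfClass (d + 2) L N ec) L k (scalarCfg (n := n) (fun y ν => ((G y ν : ℝ) : ℂ) * Complex.I))) :
    ((stepWt (d + 2) L)⁻¹) ^ k * (((N * L ^ k : ℕ) : ℝ) ^ (d + 2) * (1 - Real.cos (ω / (L : ℝ) ^ (2 * k)))) ≤ levelAction (d + 2) L N k U := by
  have hL1 : 1 ≤ L := by omega
  have hc1 : (1 : ℝ) ≤ Fintype.card n := by exact_mod_cast Fintype.card_pos
  have hc : (0 : ℝ) < Fintype.card n := by positivity
  set M : ℕ := N * L ^ k with hMdef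
  have hM : 1 ≤ M := Nat.one_le_iff_ne_zero.mpr (Nat.mul_ne_zero (by omega) (pow_ne_zero _ (by omega)))
  have hne : (periodBox (d := d + 2) M).Nonempty := by rw [← Finset.card_pos, card_periodBox]; positivity
  -- every plaquette of `U` is within `ec ≤ 1/(6n)` of `1`
  have hsmall : ∀ x : B7Prop1Explicit.Site (d + 2), ‖((hol U x (plaqWord 0 1) : (Matrix n n ℂ)ˣ) : Matrix n n ℂ) - 1‖ ≤ 1 / 3 ∧
      |(mlog ((hol U x (plaqWord 0 1) : (Matrix n n ℂ)ˣ) : Matrix n n ℂ)).trace.im / Fintype.card n| ≤ Real.pi / 2 := by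
    intro x
    have hL1r : (1 : ℝ) ≤ ((L : ℝ) ^ k) ^ 2 := one_le_pow₀ (one_le_pow₀ (by exact_mod_cast hL1))
    have hs := (hU.1.2.2 x 0 1 fin_zero_ne_one).trans (div_le_self he0 hL1r)
    have hs3 := hs.trans (regime_aux (n := n) hL he0 he2n).2.1
    exact ⟨hs3, (abs_tau_div_le (hs3.trans (by norm_num))).trans (by linarith [Real.pi_gt_three])⟩
  -- the mean of `τ_x / n` over the period box is `ω / L^{2k}`
  have hmean := mean_tau_periodBox hL hN he0 he1n he2n hωn hV01 hU
  rw [← hMdef] at hmean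
  have hJ := jensen_one_sub_cos _ hne (fun x => (mlog ((hol U x (plaqWord 0 1) : (Matrix n n ℂ)ˣ) : Matrix n n ℂ)).trace.im / Fintype.card n) (fun x _ => (hsmall x).2)
  rw [hmean, card_periodBox] at hJ
  -- per plaquette: file A
  have hP2 : ∑ x ∈ periodBox M, (1 - Real.cos ((mlog ((hol U x (plaqWord 0 1) : (Matrix n n ℂ)ˣ) : Matrix n n ℂ)).trace.im / Fintype.card n))
      ≤ ∑ x ∈ periodBox M, wt (hol U x (plaqWord 0 1)) :=
    Finset.sum_le_sum fun x _ => one_sub_cos_tau_le_wt (hol_mem_of hU.1.1 x _) (hsmall x).1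
  have hP1 := sum_perWin_ge_plane01 (n := n) hU.1.1 M
  unfold levelAction fineAction
  have hsw : 0 < ((stepWt (d + 2) L)⁻¹) ^ k := pow_pos (inv_pos.mpr (stepWt_pos L hL1)) k
  refine mul_le_mul_of_nonneg_left ?_ hsw.le
  push_cast at hJ hP1 hP2 ⊢
  exact hJ.trans (hP2.trans hP1)

omit [Nonempty n] in
/-- **The bound is attained by any competitor with CENTRAL uniform plaquette variables** (`e^{±if}·1` on the `(e₀,e₁)`-plane, `1` elsewhere): its level action is exactly
`(stepWt⁻¹)^k · (N L^k)^{d+2} · (1 − cos f)` at every rank (the Wilson weight is the NORMALISED trace). [cite: Balaban1985Variational, (5) p.278] -/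
theorem levelAction_of_central_plaquettes [Nonempty n] (L N k : ℕ) (f : ℝ) {U : B7Prop1Explicit.Site (d + 2) → Fin (d + 2) → (Matrix n n ℂ)ˣ}
    (hplaq : ∀ (x : B7Prop1Explicit.Site (d + 2)) (κ μ : Fin (d + 2)), hol U x (plaqWord κ μ)
      = expUnit ((((if κ = 0 ∧ μ = 1 then f else if κ = 1 ∧ μ = 0 then -f else 0 : ℝ) : ℂ) * Complex.I) • (1 : Matrix n n ℂ))) :
    levelAction (d + 2) L N k U = ((stepWt (d + 2) L)⁻¹) ^ k * (((N * L ^ k : ℕ) : ℝ) ^ (d + 2) * (1 - Real.cos f)) := by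
  unfold levelAction fineAction
  congr 1
  rw [perWin, Finset.sum_product]
  have hx : ∀ x : B7Prop1Explicit.Site (d + 2), ∑ π : T4AveragingDeficitWall.Plane (d + 2), wt (fhol U (x, π)) = 1 - Real.cos f := by
    intro x
    rw [← Finset.sum_erase_add _ _ (Finset.mem_univ (π₀ (d := d)))]
    have h0 : wt (fhol U (x, π₀)) = 1 - Real.cos f := by
      simp only [fhol, π₀]
      rw [hplaq]; simp only [true_and, if_true]
      exact wt_expUnit_smul_one f
    have hrest : ∑ π ∈ Finset.univ.erase (π₀ (d := d)), wt (fhol U (x, π)) = 0 := by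
      refine Finset.sum_eq_zero fun π hπ => ?_
      have hne : π ≠ π₀ := (Finset.mem_erase.mp hπ).1
      have h1 : π.1.2 ≠ 1 := snd_ne_one_of_ne hne
      have h2 : π.1.2 ≠ 0 := snd_ne_zero π
      simp only [fhol]
      rw [hplaq]
      have hc : ¬(π.1.1 = 0 ∧ π.1.2 = 1) := fun h => h1 h.2
      have hc' : ¬(π.1.1 = 1 ∧ π.1.2 = 0) := fun h => h2 h.2
      rw [if_neg hc, if_neg hc']
      have := wt_expUnit_smul_one (n := n) 0
      simp only [Real.cos_zero, sub_self] at this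
      convert this using 3
    rw [hrest, h0, zero_add]
  rw [Finset.sum_congr rfl fun x _ => hx x, Finset.sum_const, card_periodBox, nsmul_eq_mul]; push_cast; ring

/-- **★★★ THE MINIMAL ACTION ON `𝒟_unif` AT EVERY RANK**: under the hypotheses of `levelAction_ge_of_admissible` with `|ω| ≤ ec`, the minimal level-`k` action over `sfClass (d+2) L N ec`
at the datum is `(stepWt⁻¹)^k · (N L^k)^{d+2} · (1 − cos(ω∕L^{2k}))` — attained by g6 file 3's uniform preimage (every rank). [cite: Balaban1985Variational, (5)–(8) pp.278–279] -/
theorem minAct_uniformScalar (hL : 2 ≤ L) (hN : 1 ≤ N) (he0 : 0 ≤ ec) (he1n : 16 * C0 (d + 2) * (2 * Fintype.card n * ec) ≤ 3)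
    (he2n : 1024 * ((d + 2 : ℕ) + 1 : ℝ) * ((d + 2 : ℕ) + 4) * (L : ℝ) ^ 2 * (2 * Fintype.card n * ec) ≤ 1) (hωe : |ω| ≤ ec) (hωn : |Fintype.card n * ω| ≤ 1 / 2)
    (hP : IsPeriodicCfg (scalarCfg (n := n) (fun y ν => ((G y ν : ℝ) : ℂ) * Complex.I)) (N : ℤ))
    (hcurv : ∀ (x : B7Prop1Explicit.Site (d + 2)) (κ μ : Fin (d + 2)), κ ≠ μ →
      hol (scalarCfg (n := n) (fun y ν => ((G y ν : ℝ) : ℂ) * Complex.I)) x (plaqWord κ μ)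
        = expUnit ((((if κ = 0 ∧ μ = 1 then ω else if κ = 1 ∧ μ = 0 then -ω else 0 : ℝ) : ℂ) * Complex.I) • (1 : Matrix n n ℂ)))
    {U : B7Prop1Explicit.Site (d + 2) → Fin (d + 2) → (Matrix n n ℂ)ˣ}
    (hmin : IsMinimiser (d + 2) (sfClass (d + 2) L N ec) L N k (scalarCfg (n := n) (fun y ν => ((G y ν : ℝ) : ℂ) * Complex.I)) U) :
    levelAction (d + 2) L N k U = ((stepWt (d + 2) L)⁻¹) ^ k * (((N * L ^ k : ℕ) : ℝ) ^ (d + 2) * (1 - Real.cos (ω / (L : ℝ) ^ (2 * k)))) := by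
  have hc1 : (1 : ℝ) ≤ Fintype.card n := by exact_mod_cast Fintype.card_pos
  have hω : |ω| ≤ 1 / 2 := by
    rw [abs_mul, abs_of_pos (by positivity : (0 : ℝ) < Fintype.card n)] at hωn
    nlinarith [abs_nonneg ω]
  have hV01 : ∀ x : B7Prop1Explicit.Site (d + 2), hol (scalarCfg (n := n) (fun y ν => ((G y ν : ℝ) : ℂ) * Complex.I)) x (plaqWord 0 1)
      = expUnit ((((ω : ℝ) : ℂ) * Complex.I) • (1 : Matrix n n ℂ)) := fun x => by rw [hcurv x 0 1 fin_zero_ne_one]; simp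
  refine le_antisymm ?_ (levelAction_ge_of_admissible (n := n) hL hN he0 he1n he2n hωn hV01 hmin.mem)
  obtain ⟨U₀, hU₀, hU₀P, hU₀S, hU₀avg, hU₀plaq⟩ := exists_periodic_uniform_preimage (n := n) hL hN hω hP hcurv k
  have hadm : U₀ ∈ admissible (sfClass (d + 2) L N ec) L k (scalarCfg (n := n) (fun y ν => ((G y ν : ℝ) : ℂ) * Complex.I)) :=
    ⟨⟨hU₀, hU₀P, MinimalActionRate.SmallField.mono hU₀S (div_le_div_of_nonneg_right hωe (by positivity))⟩, hU₀avg⟩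
  rw [← levelAction_of_central_plaquettes (n := n) L N k (ω / (L : ℝ) ^ (2 * k)) hU₀plaq]
  exact hmin.le U₀ hadm

/-- **★★★ AT EVERY RANK, EVERY MINIMISER HAS CENTRAL UNIFORM PLAQUETTE VARIABLES** (`𝒟_unif`): `e^{±iω∕L^{2k}}·1` on the `(e₀,e₁)`-plane and `1` on every other plaquette — the three
chained inequalities of `levelAction_ge_of_admissible` are equalities: the other planes weigh `0`, so their plaquettes are `1` (file A `eq_one_of_wt_eq_zero`); each `(e₀,e₁)`-plaquette
attains `wt = 1 − cos(τ∕n)`, so it is the SCALAR `e^{iτ∕n}·1` (file A `eq_smul_one_of_wt_eq`); Jensen's equality case over the box makes every `τ_x∕n` equal to `ω∕L^{2k}`; periodicity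
moves off the box. [cite: Balaban1985Variational, Thm 1 (8)–(10) p.279] -/
theorem plaquettes_of_isMinimiser (hL : 2 ≤ L) (hN : 1 ≤ N) (he0 : 0 ≤ ec) (he1n : 16 * C0 (d + 2) * (2 * Fintype.card n * ec) ≤ 3)
    (he2n : 1024 * ((d + 2 : ℕ) + 1 : ℝ) * ((d + 2 : ℕ) + 4) * (L : ℝ) ^ 2 * (2 * Fintype.card n * ec) ≤ 1) (hωe : |ω| ≤ ec) (hωn : |Fintype.card n * ω| ≤ 1 / 2)
    (hP : IsPeriodicCfg (scalarCfg (n := n) (fun y ν => ((G y ν : ℝ) : ℂ) * Complex.I)) (N : ℤ))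
    (hcurv : ∀ (x : B7Prop1Explicit.Site (d + 2)) (κ μ : Fin (d + 2)), κ ≠ μ →
      hol (scalarCfg (n := n) (fun y ν => ((G y ν : ℝ) : ℂ) * Complex.I)) x (plaqWord κ μ)
        = expUnit ((((if κ = 0 ∧ μ = 1 then ω else if κ = 1 ∧ μ = 0 then -ω else 0 : ℝ) : ℂ) * Complex.I) • (1 : Matrix n n ℂ)))
    {U : B7Prop1Explicit.Site (d + 2) → Fin (d + 2) → (Matrix n n ℂ)ˣ}
    (hmin : IsMinimiser (d + 2) (sfClass (d + 2) L N ec) L N k (scalarCfg (n := n) (fun y ν => ((G y ν : ℝ) : ℂ) * Complex.I)) U) :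
    ∀ (x : B7Prop1Explicit.Site (d + 2)) (κ μ : Fin (d + 2)), κ ≠ μ → hol U x (plaqWord κ μ)
      = expUnit ((((if κ = 0 ∧ μ = 1 then ω / (L : ℝ) ^ (2 * k) else if κ = 1 ∧ μ = 0 then -(ω / (L : ℝ) ^ (2 * k)) else 0 : ℝ) : ℂ) * Complex.I) •
        (1 : Matrix n n ℂ)) := by
  have hL1 : 1 ≤ L := by omega
  have hc1 : (1 : ℝ) ≤ Fintype.card n := by exact_mod_cast Fintype.card_pos
  have hc : (0 : ℝ) < Fintype.card n := by positivity
  set f : ℝ := ω / (L : ℝ) ^ (2 * k) with hf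
  have hV01 : ∀ x : B7Prop1Explicit.Site (d + 2), hol (scalarCfg (n := n) (fun y ν => ((G y ν : ℝ) : ℂ) * Complex.I)) x (plaqWord 0 1)
      = expUnit ((((ω : ℝ) : ℂ) * Complex.I) • (1 : Matrix n n ℂ)) := fun x => by rw [hcurv x 0 1 fin_zero_ne_one]; simp
  have hval := minAct_uniformScalar (n := n) hL hN he0 he1n he2n hωe hωn hP hcurv hmin
  have hadm := hmin.mem
  set M : ℕ := N * L ^ k with hMdef
  have hM : 1 ≤ M := Nat.one_le_iff_ne_zero.mpr (Nat.mul_ne_zero (by omega) (pow_ne_zero _ (by omega)))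
  have hne : (periodBox (d := d + 2) M).Nonempty := by rw [← Finset.card_pos, card_periodBox]; positivity
  -- every plaquette of `U` is within `ec ≤ 1/(6n)` of `1`
  have hec : ec ≤ 1 / 3 := (regime_aux (n := n) hL he0 he2n).2.1
  have hsmall : ∀ (x : B7Prop1Explicit.Site (d + 2)) (κ μ : Fin (d + 2)), κ ≠ μ → ‖((hol U x (plaqWord κ μ) : (Matrix n n ℂ)ˣ) : Matrix n n ℂ) - 1‖ ≤ 1 / 3 := by
    intro x κ μ hκμ
    have hL1r : (1 : ℝ) ≤ ((L : ℝ) ^ k) ^ 2 := one_le_pow₀ (one_le_pow₀ (by exact_mod_cast hL1))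
    exact ((hadm.1.2.2 x κ μ hκμ).trans (div_le_self he0 hL1r)).trans hec
  have hθ : ∀ x ∈ periodBox (d := d + 2) M, |(mlog ((hol U x (plaqWord 0 1) : (Matrix n n ℂ)ˣ) : Matrix n n ℂ)).trace.im / Fintype.card n| ≤ Real.pi / 2 := by
    intro x _
    exact (abs_tau_div_le ((hsmall x 0 1 fin_zero_ne_one).trans (by norm_num))).trans (by linarith [hsmall x 0 1 fin_zero_ne_one, Real.pi_gt_three])
  -- the mean of `τ_x / n` is `f`
  have hmean : (∑ x ∈ periodBox M, (mlog ((hol U x (plaqWord 0 1) : (Matrix n n ℂ)ˣ) : Matrix n n ℂ)).trace.im / Fintype.card n) / (periodBox (d := d + 2) M).card = f := by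
    rw [hf, hMdef]; exact mean_tau_periodBox hL hN he0 he1n he2n hωn hV01 hadm
  -- the three inequalities and their total
  have hsw : 0 < ((stepWt (d + 2) L)⁻¹) ^ k := pow_pos (inv_pos.mpr (stepWt_pos L hL1)) k
  have hJ := jensen_one_sub_cos _ hne (fun x => (mlog ((hol U x (plaqWord 0 1) : (Matrix n n ℂ)ˣ) : Matrix n n ℂ)).trace.im / Fintype.card n) hθ
  have hP2le : ∀ x ∈ periodBox (d := d + 2) M, 1 - Real.cos ((mlog ((hol U x (plaqWord 0 1) : (Matrix n n ℂ)ˣ) : Matrix n n ℂ)).trace.im / Fintype.card n)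
      ≤ wt (hol U x (plaqWord 0 1)) := fun x _ => one_sub_cos_tau_le_wt (hol_mem_of hadm.1.1 x _) (hsmall x 0 1 fin_zero_ne_one)
  have hP2 := Finset.sum_le_sum hP2le
  have hP1 := sum_perWin_ge_plane01 (n := n) hadm.1.1 M
  rw [hmean, card_periodBox] at hJ
  unfold levelAction fineAction at hval
  rw [← hMdef] at hval
  have hval' : ∑ p ∈ perWin (d + 2) M, wt (fhol U p) = ((M : ℕ) : ℝ) ^ (d + 2) * (1 - Real.cos f) := by
    have := mul_left_cancel₀ hsw.ne' hval
    rw [this]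
  push_cast at hJ hval' hP1 hP2
  have heq1 : ∑ p ∈ perWin (d + 2) M, wt (fhol U p) = ∑ x ∈ periodBox M, wt (hol U x (plaqWord 0 1)) := by linarith
  have heq2 : ∑ x ∈ periodBox M, wt (hol U x (plaqWord 0 1))
      = ∑ x ∈ periodBox M, (1 - Real.cos ((mlog ((hol U x (plaqWord 0 1) : (Matrix n n ℂ)ˣ) : Matrix n n ℂ)).trace.im / Fintype.card n)) := by linarith
  have heq3 : ∑ x ∈ periodBox M, (1 - Real.cos ((mlog ((hol U x (plaqWord 0 1) : (Matrix n n ℂ)ˣ) : Matrix n n ℂ)).trace.im / Fintype.card n))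
      = ((periodBox (d := d + 2) M).card : ℝ) * (1 - Real.cos ((∑ x ∈ periodBox M, (mlog ((hol U x (plaqWord 0 1) : (Matrix n n ℂ)ˣ) : Matrix n n ℂ)).trace.im / Fintype.card n) /
          (periodBox (d := d + 2) M).card)) := by
    rw [hmean, card_periodBox]; push_cast; linarith
  -- equality cases
  have hall := jensen_one_sub_cos_eq_iff _ hne _ hθ heq3
  rw [hmean] at hall
  have hterm := (Finset.sum_eq_sum_iff_of_le hP2le).mp heq2.symm
  -- conclusion on the period box for `(0,1)`: the plaquette is the scalar `e^{if}·1`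
  have h01 : ∀ x ∈ periodBox (d := d + 2) M, hol U x (plaqWord 0 1) = expUnit ((((f : ℝ) : ℂ) * Complex.I) • (1 : Matrix n n ℂ)) := by
    intro x hx
    have hrig := eq_smul_one_of_wt_eq (hol_mem_of hadm.1.1 x _) (hsmall x 0 1 fin_zero_ne_one) (hterm x hx).symm
    rw [hall x hx] at hrig
    apply Units.ext
    rw [hrig, val_expUnit, ← cexp_smul_one]
  -- the other planes weigh zero on the period box, hence are `1`
  have hoff : ∀ x ∈ periodBox (d := d + 2) M, ∀ (α β : Fin (d + 2)), α < β → ¬(α = 0 ∧ β = 1) → hol U x (plaqWord α β) = 1 := by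
    intro x hx α β hαβ hne01
    have hπne : (⟨(α, β), hαβ⟩ : T4AveragingDeficitWall.Plane (d + 2)) ≠ π₀ := by
      intro h
      have h' := congrArg (fun π : T4AveragingDeficitWall.Plane (d + 2) => π.1) h
      simp only [π₀] at h'
      exact hne01 ⟨(Prod.mk.inj h').1, (Prod.mk.inj h').2⟩
    have hw := wt_eq_zero_of_sum_perWin_eq (n := n) hadm.1.1 M heq1 hx hπne
    simp only [fhol] at hw
    exact eq_one_of_wt_eq_zero (hol_mem_of hadm.1.1 x _) (hsmall x α β (ne_of_lt hαβ)) hw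
  -- orientation reversal
  have hswap : ∀ (y : B7Prop1Explicit.Site (d + 2)) (α β : Fin (d + 2)), hol U y (plaqWord β α) = (hol U y (plaqWord α β))⁻¹ := by
    intro y α β
    rw [show plaqWord β α = revWord (plaqWord α β) from rfl]
    exact hol_revWord' U y (plaqWord α β) (by rw [disp_plaqWord, add_zero])
  -- periodicity moves every site into the period box
  have hwrap : ∀ y : B7Prop1Explicit.Site (d + 2), ∃ x ∈ periodBox (d := d + 2) M, ∀ α β : Fin (d + 2), hol U y (plaqWord α β) = hol U x (plaqWord α β) := fun y =>
    ⟨fun ι => y ι % (M : ℤ), wrap_mem_periodBox M hM y, fun α β =>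
      (apply_wrap_eq (g := fun z => hol U z (plaqWord α β)) (P := M) (fun z ι => hol_add_period hadm.1.2.1 ι _ z) y).symm⟩
  intro x κ μ hκμ
  obtain ⟨x₀, hx₀, hxw⟩ := hwrap x
  rw [hxw κ μ]
  by_cases h01c : κ = 0 ∧ μ = 1
  · obtain ⟨rfl, rfl⟩ := h01c
    rw [if_pos ⟨rfl, rfl⟩, h01 x₀ hx₀]
  rw [if_neg h01c]
  by_cases h10 : κ = 1 ∧ μ = 0
  · obtain ⟨rfl, rfl⟩ := h10
    rw [if_pos ⟨rfl, rfl⟩, hswap x₀ 0 1, h01 x₀ hx₀, val_inv_expUnit]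
    congr 1
    rw [← neg_smul]; push_cast; ring_nf
  rw [if_neg h10]
  rcases lt_or_gt_of_ne hκμ with hlt | hgt
  · rw [hoff x₀ hx₀ κ μ hlt h01c]
    apply Units.ext
    rw [val_expUnit, ← cexp_smul_one]; simp
  · rw [hswap x₀ μ κ, hoff x₀ hx₀ μ κ hgt (fun h => h10 ⟨h.2, h.1⟩), inv_one]
    apply Units.ext
    rw [val_expUnit, ← cexp_smul_one]; simp

end Minimisers

end

end Summit.QuantumFields.YangMills.BalabanUVNodes.N16RankNUniformScalarMinimisers
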